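import Literature.AlgebraicGeometry.HilbertScheme.HeisenbergMonomialIndependence
import HarnessLib

/-!
# The Heisenberg monomial basis is GRADED: monomials of cohomological degree `d` form a basis of `Hᵈ(S^[n])`

Layer `Literature/AlgebraicGeometry/HilbertScheme`; sequel of `HeisenbergMonomialSpanning` /
`HeisenbergMonomialIndependence` (the Nakajima–Grojnowski basis theorem for `ℍₙ = H*(S^[n])`, proved from the axioms).
The bi-degree axiom of `IsHeisenbergRepresentation` ("`𝔮ₘ(α)` is homogeneous of bi-degree `(m, 2m − 2 + |α|)`", LQW
Def. 2.9; Nakajima/Göttsche: the monomial `Π 𝔮_{rⱼ}(x_{cⱼ})|0⟩` has cohomological degree `Σⱼ (2rⱼ − 2 + |x_{cⱼ}|)`)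
refines the basis degree by degree — this is the form in which a computational model graded by `(n, degree)` meets
`H*(S^[n])`, and the source of Göttsche's Betti number formula.  Everything here is PROVED (0 facts):

* `pvDegree deg n ρ = Σ_{c,r} (2(r − 1) + |x_c|)·m_r(c)` — the cohomological degree of the monomial of `ρ`;
* `IsHeisenbergRepresentation.heisenbergMonomial_mem_range_of` — the monomial of `ρ ∈ 𝒫ₙ` lies in
  `ℍ^{n, pvDegree ρ}`;
* `IsHeisenbergRepresentation.span_heisenbergMonomial_of_degree_eq_range` /
  `linearIndependent_heisenbergMonomial_of_degree` — for every `(n, d)` the monomials with `pvDegree ρ = d` are a basis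
  of `ℍ^{n,d}` (generic: any representation satisfying the axioms over a field with `2 ≠ 0`, resp. of characteristic
  zero with a dual family);
* `NakajimaOperators.heisenbergMonomial_basis_of_degree` — on the tree's carriers (`ℍ^{n,d} = Hᵈ(S^[n](ℂ); ℂ)`), and
  `NakajimaOperators.finrank_eq_nat_card_partitionValued` — **`b_d(S^[n]) = #{ρ ∈ 𝒫ₙ : pvDegree ρ = d}`** (the
  counting form of Göttsche's formula, for every surface carrying Nakajima operators);
* `NakajimaOperators.heisenbergMonomialBasisSummand` / `heisenbergMonomialBasisOfDegree` — the same bases PACKAGED as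
  `Module.Basis` of `ℍₙ = ⨁_d Hᵈ(S^[n](ℂ); ℂ)` (the tree's `totalCohomology` of `S^[n]`) and of `Hᵈ(S^[n](ℂ); ℂ)`
  (`complexBetti`), with `_apply`: the `ρ`-th vector is the monomial `Π_c 𝔞_{−ρ(c)}(x_c)|0⟩` read in `ℍ`.

## References

* H. Nakajima, Ann. of Math. 145 (1997) [`Nakajima1997`], Thm. 1.2 / §8 (the basis and Göttsche's formula);
  L. Göttsche, Math. Ann. 286 (1990) [`Gottsche1990`] (Betti numbers of `S^[n]`).
* W.-P. Li, Z. Qin, W. Wang, Math. Ann. 324 (2002) [`LiQinWang2002`], Def. 2.5, Def. 2.9 (bi-degrees) p. 4–5;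
  J. reine angew. Math. 554 (2003) [`LiQinWang2003`], §6 p. 13.
* M. Lehn, Invent. Math. 136 (1999) [`Lehn1999`], Cor. 2.6.

HONEST FRAMING: nothing here asserts L1 / `LefschetzGenerationHilb n` / MODEL_X / HC_Kum4Type / HC; the Göttsche FACT
`Gottsche1990_bettiNumbers_hilbertSchemeOfPoints` (all smooth projective surfaces, closed product formula) is NOT
discharged here (that needs the existence of Nakajima operators for every surface and the product-formula count).
-/

noncomputable section

open DirectSum

universe u v w

namespace Literature.AlgebraicGeometry.HilbertScheme

/-! ### 1. Cohomological degrees of words and of partition-valued functions -/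

section Degrees

variable {V : Type v} {N : ℕ}

/-- The cohomological degree `2(r − 1) + |x_c|` of the creation letter `𝔮_r(x_c)` (bi-degree `(r, 2r − 2 + |x_c|)`).
[cite: LiQinWang2002, Def. 2.9 p. 5] -/
def letterDeg (deg : Fin N → ℕ) (σ : Lex (Fin N × ℕ)) : ℕ :=
  2 * (letterPart σ - 1) + deg (letterColour σ)

/-- The cohomological degree `Σⱼ (2(rⱼ − 1) + |x_{cⱼ}|)` of a word of letters. [cite: LiQinWang2002, Def. 2.9 p. 5] -/
def wordDeg (deg : Fin N → ℕ) (L : List (Lex (Fin N × ℕ))) : ℕ :=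
  (L.map (letterDeg deg)).sum

/-- Degree of the empty word. [cite: LiQinWang2002, Def. 2.9 p. 5] -/
@[simp]
theorem wordDeg_nil (deg : Fin N → ℕ) : wordDeg deg [] = 0 := by
  simp [wordDeg]

/-- Degree of `σ :: L`. [cite: LiQinWang2002, Def. 2.9 p. 5] -/
@[simp]
theorem wordDeg_cons (deg : Fin N → ℕ) (σ : Lex (Fin N × ℕ)) (L : List (Lex (Fin N × ℕ))) :
    wordDeg deg (σ :: L) = letterDeg deg σ + wordDeg deg L := by
  simp [wordDeg]

/-- Degree is additive under concatenation. [cite: LiQinWang2002, Def. 2.9 p. 5] -/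
theorem wordDeg_append (deg : Fin N → ℕ) (L L' : List (Lex (Fin N × ℕ))) :
    wordDeg deg (L ++ L') = wordDeg deg L + wordDeg deg L' := by
  simp [wordDeg, List.sum_append]

/-- Degree of a `flatMap`. [cite: LiQinWang2002, Def. 2.9 p. 5] -/
theorem wordDeg_flatMap {α : Type*} (deg : Fin N → ℕ) (l : List α) (f : α → List (Lex (Fin N × ℕ))) :
    wordDeg deg (l.flatMap f) = (l.map fun a ↦ wordDeg deg (f a)).sum := by
  induction l with
  | nil => simp
  | cons a l ih => rw [List.flatMap_cons, wordDeg_append, ih, List.map_cons, List.sum_cons]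

/-- Degree of a repeated letter. [cite: LiQinWang2002, Def. 2.9 p. 5] -/
theorem wordDeg_replicate (deg : Fin N → ℕ) (k : ℕ) (σ : Lex (Fin N × ℕ)) :
    wordDeg deg (List.replicate k σ) = k * letterDeg deg σ := by
  simp [wordDeg, List.map_replicate, List.sum_replicate]

/-- **The cohomological degree of the monomial of `ρ`**: `Σ_{c, r} (2(r − 1) + |x_c|) · m_r(c)` (Nakajima/Göttsche:
`𝔮_r(x_c)` raises the cohomological degree by `2r − 2 + |x_c|`). [cite: LiQinWang2002, Def. 2.9 p. 5]
[cite: Nakajima1997, Thm. 1.2 / §8] -/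
def pvDegree (deg : Fin N → ℕ) (n : ℕ) (ρ : Fin N → Fin (n + 1) → ℕ) : ℕ :=
  ∑ c, ∑ r : Fin (n + 1), (2 * ((r : ℕ) - 1) + deg c) * ρ c r

/-- The degree of the canonical word of `ρ` is `pvDegree ρ`. [cite: LiQinWang2002, Def. 2.9 p. 5] -/
theorem wordDeg_canonList (deg : Fin N → ℕ) (n : ℕ) (ρ : Fin N → Fin (n + 1) → ℕ) :
    wordDeg deg (canonList n ρ) = pvDegree deg n ρ := by
  unfold canonList pvDegree
  rw [wordDeg_flatMap, Fin.sum_univ_def]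
  refine congrArg List.sum (List.map_congr_left fun c _ ↦ ?_)
  rw [wordDeg_flatMap, Fin.sum_univ_def]
  refine congrArg List.sum (List.map_congr_left fun r _ ↦ ?_)
  rw [wordDeg_replicate, mul_comm]
  rfl

end Degrees

/-! ### 2. Monomials are bi-homogeneous -/

section Representation

variable {K : Type u} [Field K]
variable {A : ℕ → Type v} [∀ i, AddCommGroup (A i)] [∀ i, Module K (A i)]
variable {Φ : ℕ → ℕ → Type w} [∀ n i, AddCommGroup (Φ n i)] [∀ n i, Module K (Φ n i)]
variable {B : (⨁ i, A i) →ₗ[K] (⨁ i, A i) →ₗ[K] K} {q : ℤ → (⨁ i, A i) →ₗ[K] Module.End K (Fock Φ)} {vac : Fock Φ}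
variable {N : ℕ} {x y : Fin N → ⨁ i, A i} {deg codeg : Fin N → ℕ}

namespace IsHeisenbergRepresentation

/-- The bi-degree axiom in range form: `𝔮ₘ(a)`, `a ∈ Aⁱ`, maps `ℍ^{p,k}` into `ℍ^{p',k'}` for `p' = p + m`,
`k' = k + 2m − 2 + i`. [cite: LiQinWang2002, Def. 2.9 p. 5] -/
theorem apply_mem_range_of (h : IsHeisenbergRepresentation B q vac) (m : ℤ) (i : ℕ) (a : A i) {p k p' k' : ℕ}
    (hp : (p : ℤ) + m = p') (hk : (k : ℤ) + 2 * m - 2 + i = k') {w : Fock Φ}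
    (hw : w ∈ LinearMap.range (Fock.of K Φ p k)) : q m (lof K ℕ A i a) w ∈ LinearMap.range (Fock.of K Φ p' k') := by
  obtain ⟨z, rfl⟩ := hw
  have := h.bidegree m i a p k z
  rwa [hp, hk, bidegPart_natCast] at this

/-- **A creation monomial is bi-homogeneous**: `Π_L 𝔮_{rⱼ}(x_{cⱼ})|0⟩ ∈ ℍ^{Σ rⱼ, Σ (2rⱼ − 2 + |x_{cⱼ}|)}` (all parts
`≥ 1`). [cite: LiQinWang2002, Def. 2.5 and Def. 2.9 pp. 4–5] [cite: Nakajima1997, Thm. 1.2 / §8] -/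
theorem letterMonomial_vac_mem_range_of (h : IsHeisenbergRepresentation B q vac)
    (hx : ∀ c, x c ∈ LinearMap.range (lof K ℕ A (deg c))) :
    ∀ {L : List (Lex (Fin N × ℕ))}, (∀ σ ∈ L, 1 ≤ letterPart σ) →
      monomialOp q (letterWord x L) vac ∈
        LinearMap.range (Fock.of K Φ (wordMode (letterWord x L)) (wordDeg deg L)) := by
  intro L
  induction L with
  | nil =>
    intro _
    rw [letterWord_nil, monomialOp_nil, Module.End.one_apply, wordMode_nil, wordDeg_nil]
    have h0 := h.vac_mem
    rwa [show ((0 : ℤ)) = ((0 : ℕ) : ℤ) from rfl, bidegPart_natCast] at h0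
  | cons τ L ih =>
    intro hL
    have hτ : 1 ≤ letterPart τ := hL τ List.mem_cons_self
    have ihL := ih fun σ hσ ↦ hL σ (List.mem_cons_of_mem τ hσ)
    obtain ⟨a, ha⟩ := hx (letterColour τ)
    rw [letterWord_cons, monomialOp_cons, Module.End.mul_apply, wordMode_cons, wordDeg_cons, ← ha]
    refine h.apply_mem_range_of _ _ a (by push_cast; ring) ?_ ihL
    simp only [letterDeg]
    push_cast [Nat.cast_sub hτ]
    ring

/-- **The monomial of `ρ ∈ 𝒫ₙ` lies in `ℍ^{n, pvDegree ρ}`** (`= H^{pvDegree ρ}(S^[n])` on the geometric instance).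
[cite: LiQinWang2002, Def. 2.9 p. 5] [cite: Nakajima1997, Thm. 1.2 / §8] -/
theorem heisenbergMonomial_mem_range_of (h : IsHeisenbergRepresentation B q vac)
    (hx : ∀ c, x c ∈ LinearMap.range (lof K ℕ A (deg c))) {n : ℕ} {ρ : Fin N → Fin (n + 1) → ℕ}
    (hρ : IsPartitionValued deg n ρ) :
    heisenbergMonomial q vac x n ρ ∈ LinearMap.range (Fock.of K Φ n (pvDegree deg n ρ)) := by
  have hparts : ∀ σ ∈ canonList n ρ, 1 ≤ letterPart σ := (isAdmissibleWord_canonList hρ).1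
  have hmem := h.letterMonomial_vac_mem_range_of hx hparts
  have hn : wordMode (letterWord x (canonList n ρ)) = n := by rw [letterWord_canonList, wordMode_pvWord, hρ.2.2]
  rwa [hn, wordDeg_canonList, letterWord_canonList] at hmem

/-! ### 3. The graded basis -/

/-- **For every `(n, d)` the monomials of `ρ ∈ 𝒫ₙ` with `pvDegree ρ = d` SPAN `ℍ^{n,d}`** (project the spanning of
`ℍₙ` onto the bigraded piece). [cite: Nakajima1997, Thm. 1.2 / §8] [cite: LiQinWang2003, §6 p. 13]
[cite: LiQinWang2002, Def. 2.9 p. 5] -/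
theorem span_heisenbergMonomial_of_degree_eq_range (h : IsHeisenbergRepresentation B q vac) (h2 : (2 : K) ≠ 0)
    (hx : ∀ c, x c ∈ LinearMap.range (lof K ℕ A (deg c))) (hsp : Submodule.span K (Set.range x) = ⊤) (n d : ℕ) :
    Submodule.span K (Set.range fun ρ : {ρ : Fin N → Fin (n + 1) → ℕ //
        IsPartitionValued deg n ρ ∧ pvDegree deg n ρ = d} ↦ heisenbergMonomial q vac x n ρ.1) =
      LinearMap.range (Fock.of K Φ n d) := by
  classical
  apply le_antisymm
  · rw [Submodule.span_le]
    rintro _ ⟨ρ, rfl⟩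
    have := h.heisenbergMonomial_mem_range_of hx ρ.2.1
    rw [ρ.2.2] at this
    exact this
  · rintro _ ⟨z, rfl⟩
    let P : Module.End K (Fock Φ) := Fock.of K Φ n d ∘ₗ DirectSum.component K ℕ (Φ n) d ∘ₗ
      DirectSum.component K ℕ (fun p ↦ FockSummand Φ p) n
    have hfix : P (Fock.of K Φ n d z) = Fock.of K Φ n d z := by
      simp only [P, LinearMap.comp_apply, DirectSum.component.lof_self]
    have hmem : Fock.of K Φ n d z ∈ Submodule.span K (Set.range fun ρ : {ρ : Fin N → Fin (n + 1) → ℕ //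
        IsPartitionValued deg n ρ} ↦ heisenbergMonomial q vac x n ρ.1) := by
      rw [h.span_heisenbergMonomial_eq_range h2 hx hsp n]
      exact ⟨lof K ℕ (Φ n) d z, rfl⟩
    rw [← hfix]
    have hmap : (Submodule.span K (Set.range fun ρ : {ρ : Fin N → Fin (n + 1) → ℕ //
        IsPartitionValued deg n ρ} ↦ heisenbergMonomial q vac x n ρ.1)).map P ≤
        Submodule.span K (Set.range fun ρ : {ρ : Fin N → Fin (n + 1) → ℕ //
          IsPartitionValued deg n ρ ∧ pvDegree deg n ρ = d} ↦ heisenbergMonomial q vac x n ρ.1) := by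
      rw [Submodule.map_span, Submodule.span_le]
      rintro _ ⟨_, ⟨ρ, rfl⟩, rfl⟩
      obtain ⟨z', hz'⟩ := h.heisenbergMonomial_mem_range_of hx ρ.2
      by_cases hd : pvDegree deg n ρ.1 = d
      · refine Submodule.subset_span ⟨⟨ρ.1, ρ.2, hd⟩, ?_⟩
        change heisenbergMonomial q vac x n ρ.1 = P (heisenbergMonomial q vac x n ρ.1)
        rw [← hz']
        subst hd
        simp only [P, LinearMap.comp_apply, DirectSum.component.lof_self]
      · have hkill : P (heisenbergMonomial q vac x n ρ.1) = 0 := by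
          rw [← hz']
          simp only [P, LinearMap.comp_apply, DirectSum.component.lof_self]
          rw [DirectSum.component.of, dif_neg hd, map_zero, map_zero]
        rw [SetLike.mem_coe, hkill]
        exact Submodule.zero_mem _
    exact hmap (Submodule.mem_map_of_mem hmem)

/-- **… and are LINEARLY INDEPENDENT** (a sub-family of the basis of `ℍₙ`; characteristic zero, dual family `y`).
[cite: Nakajima1997, Thm. 1.2 / §8] [cite: LiQinWang2003, §6 pp. 13–14] -/
theorem linearIndependent_heisenbergMonomial_of_degree [CharZero K] (h : IsHeisenbergRepresentation B q vac)
    (hx : ∀ c, x c ∈ LinearMap.range (lof K ℕ A (deg c))) (hy : ∀ c, y c ∈ LinearMap.range (lof K ℕ A (codeg c)))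
    (hB : ∀ c c', B (y c) (x c') = if c = c' then 1 else 0) (n d : ℕ) :
    LinearIndependent K (fun ρ : {ρ : Fin N → Fin (n + 1) → ℕ //
      IsPartitionValued deg n ρ ∧ pvDegree deg n ρ = d} ↦ heisenbergMonomial q vac x n ρ.1) :=
  (h.linearIndependent_heisenbergMonomial hx hy hB n).comp
    (fun ρ : {ρ : Fin N → Fin (n + 1) → ℕ // IsPartitionValued deg n ρ ∧ pvDegree deg n ρ = d} ↦
      (⟨ρ.1, ρ.2.1⟩ : {ρ : Fin N → Fin (n + 1) → ℕ // IsPartitionValued deg n ρ}))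
    (by
      intro ρ ρ' hh
      apply Subtype.ext
      have hval := congrArg Subtype.val hh
      exact hval)

end IsHeisenbergRepresentation

end Representation

/-! ### 4. On the tree's carriers: a basis of `Hᵈ(S^[n](ℂ); ℂ)` and the Betti numbers as a count -/

section Geometric

open Literature.AlgebraicGeometry.Motives (SchemeOver ComplexPoints IsSmoothProjective)
open Literature.AlgebraicGeometry.Hyperkaehler (totalCohomology ofDegree)
open Literature.AlgebraicGeometry.HodgeTheory (complexBetti)

variable {S : SchemeOver ℂ} {hS : IsSmoothProjective 2 S} {H : HilbertSchemesOfPoints S}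

/-- **Nakajima–Grojnowski, graded**: for Nakajima operators `𝔑` of `S`, a homogeneous basis `x` of `H*(S(ℂ); ℂ)`
(`x_c ∈ H^{|x_c|}`) and every `(n, d)`, the monomials `Π_c 𝔞_{−ρ(c)}(x_c)|0⟩` with `ρ ∈ 𝒫ₙ` and
`Σ (2(r−1) + |x_c|) m_r(c) = d` form a basis of `ℍ^{n,d} = Hᵈ(S^[n](ℂ); ℂ) ⊂ ℍ`.
[cite: Nakajima1997, Thm. 1.2 / §8] [cite: Grojnowski1996, Thm. 1] [cite: LiQinWang2003, §6 pp. 13–14]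
[cite: LiQinWang2002, Def. 2.9 p. 5] -/
theorem NakajimaOperators.heisenbergMonomial_basis_of_degree (𝔑 : NakajimaOperators hS H) {N : ℕ}
    {x : Fin N → totalCohomology ℂ (ComplexPoints S)} {deg : Fin N → ℕ}
    (hdeg : ∀ c, x c ∈ LinearMap.range (ofDegree ℂ (ComplexPoints S) (deg c))) (hli : LinearIndependent ℂ x)
    (hsp : Submodule.span ℂ (Set.range x) = ⊤) (n d : ℕ) :
    LinearIndependent ℂ (fun ρ : {ρ : Fin N → Fin (n + 1) → ℕ //
        IsPartitionValued deg n ρ ∧ pvDegree deg n ρ = d} ↦ heisenbergMonomial 𝔑.q (vacuumVector H) x n ρ.1) ∧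
      Submodule.span ℂ (Set.range fun ρ : {ρ : Fin N → Fin (n + 1) → ℕ //
          IsPartitionValued deg n ρ ∧ pvDegree deg n ρ = d} ↦ heisenbergMonomial 𝔑.q (vacuumVector H) x n ρ.1) =
        LinearMap.range (Fock.of ℂ (fockFamily H) n d) := by
  obtain ⟨y, hy, hB⟩ := exists_homogeneous_dual_family hS hdeg hli hsp
  exact ⟨𝔑.isHeisenberg.linearIndependent_heisenbergMonomial_of_degree (codeg := fun c ↦ 4 - deg c) hdeg hy hB n d,
    𝔑.isHeisenberg.span_heisenbergMonomial_of_degree_eq_range two_ne_zero hdeg hsp n d⟩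

/-- **The Betti numbers of `S^[n]` as a count (Göttsche's formula in counting form, for every surface carrying Nakajima
operators)**: `b_d(S^[n]) = #{ρ ∈ 𝒫ₙ : Σ (2(r−1) + |x_c|) m_r(c) = d}` for any homogeneous basis `x` of `H*(S(ℂ); ℂ)`.
[cite: Nakajima1997, Thm. 1.2 / §8 (the basis implies Göttsche's formula)] [cite: Gottsche1990, Thm. 0.1] -/
theorem NakajimaOperators.finrank_eq_nat_card_partitionValued (𝔑 : NakajimaOperators hS H) {N : ℕ}
    {x : Fin N → totalCohomology ℂ (ComplexPoints S)} {deg : Fin N → ℕ}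
    (hdeg : ∀ c, x c ∈ LinearMap.range (ofDegree ℂ (ComplexPoints S) (deg c))) (hli : LinearIndependent ℂ x)
    (hsp : Submodule.span ℂ (Set.range x) = ⊤) (n d : ℕ) :
    Module.finrank ℂ (complexBetti (H.obj n) d) =
      Nat.card {ρ : Fin N → Fin (n + 1) → ℕ // IsPartitionValued deg n ρ ∧ pvDegree deg n ρ = d} := by
  obtain ⟨hind, hspan⟩ := 𝔑.heisenbergMonomial_basis_of_degree hdeg hli hsp n d
  -- the basis of `range (Fock.of n d)`, transported along `Hᵈ(S^[n]) ≅ range (Fock.of n d)`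
  have hinj : Function.Injective (Fock.of ℂ (fockFamily H) n d) := by
    intro a b hab
    have := congrArg (fun w ↦ DirectSum.component ℂ ℕ (fockFamily H n) d
      (DirectSum.component ℂ ℕ (fun p ↦ FockSummand (fockFamily H) p) n w)) hab
    simpa [DirectSum.component.lof_self] using this
  let b := (Module.Basis.span hind).map (LinearEquiv.ofEq _ _ hspan)
  rw [(LinearEquiv.ofInjective _ hinj).finrank_eq, Module.finrank_eq_nat_card_basis b]

end Geometric

/-! ### 5. Packaged bases of `Hᵈ(S^[n](ℂ); ℂ)` and of `H*(S^[n](ℂ); ℂ)` indexed by partition-valued functions -/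

section Bases

open Literature.AlgebraicGeometry.Motives (SchemeOver ComplexPoints IsSmoothProjective)
open Literature.AlgebraicGeometry.Hyperkaehler (totalCohomology ofDegree)
open Literature.AlgebraicGeometry.HodgeTheory (complexBetti)

variable {S : SchemeOver ℂ} {hS : IsSmoothProjective 2 S} {H : HilbertSchemesOfPoints S}

/-- `ℍₙ → ℍ` is injective (plumbing). [cite: LiQinWang2002, Def. 2.5 (i) p. 4] -/
theorem Fock.ofSummand_injective {K : Type u} [Field K] {Φ : ℕ → ℕ → Type w} [∀ n i, AddCommGroup (Φ n i)]
    [∀ n i, Module K (Φ n i)] (n : ℕ) : Function.Injective (Fock.ofSummand K Φ n) := by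
  classical
  intro a b hab
  have := congrArg (DirectSum.component K ℕ (fun p ↦ FockSummand Φ p) n) hab
  simpa [DirectSum.component.lof_self] using this

/-- `ℍ^{n,d} → ℍ` is injective (plumbing). [cite: LiQinWang2002, Def. 2.5 (i) p. 4] -/
theorem Fock.of_injective {K : Type u} [Field K] {Φ : ℕ → ℕ → Type w} [∀ n i, AddCommGroup (Φ n i)]
    [∀ n i, Module K (Φ n i)] (n d : ℕ) : Function.Injective (Fock.of K Φ n d) := by
  classical
  intro a b hab
  have := congrArg (fun w ↦ DirectSum.component K ℕ (Φ n) d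
    (DirectSum.component K ℕ (fun p ↦ FockSummand Φ p) n w)) hab
  simpa [DirectSum.component.lof_self] using this

/-- **The Heisenberg monomial basis of `H*(S^[n](ℂ); ℂ)` indexed by `𝒫ₙ`**, as a `Module.Basis` of the summand
`ℍₙ = ⨁_d Hᵈ(S^[n](ℂ); ℂ)` (the tree's `totalCohomology ℂ (S^[n])(ℂ)` on the nose), for Nakajima operators `𝔑` and a
homogeneous basis `x` of `H*(S(ℂ); ℂ)`; its `ρ`-th vector maps to `Π_c 𝔞_{−ρ(c)}(x_c)|0⟩` in `ℍ`
(`heisenbergMonomialBasisSummand_apply`). [cite: Nakajima1997, Thm. 1.2 / §8] [cite: LiQinWang2003, §6 pp. 13–14]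
[cite: Lehn1999, Cor. 2.6] -/
def NakajimaOperators.heisenbergMonomialBasisSummand (𝔑 : NakajimaOperators hS H) {N : ℕ}
    {x : Fin N → totalCohomology ℂ (ComplexPoints S)} {deg : Fin N → ℕ}
    (hdeg : ∀ c, x c ∈ LinearMap.range (ofDegree ℂ (ComplexPoints S) (deg c))) (hli : LinearIndependent ℂ x)
    (hsp : Submodule.span ℂ (Set.range x) = ⊤) (n : ℕ) :
    Module.Basis {ρ : Fin N → Fin (n + 1) → ℕ // IsPartitionValued deg n ρ} ℂ (FockSummand (fockFamily H) n) :=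
  ((Module.Basis.span (𝔑.heisenbergMonomial_basis hdeg hli hsp n).1).map
    (LinearEquiv.ofEq _ _ (𝔑.heisenbergMonomial_basis hdeg hli hsp n).2)).map
      (LinearEquiv.ofInjective _ (Fock.ofSummand_injective (K := ℂ) (Φ := fockFamily H) n)).symm

/-- The `ρ`-th basis vector of `ℍₙ` is the monomial `Π_c 𝔞_{−ρ(c)}(x_c)|0⟩` (read in `ℍ`).
[cite: Nakajima1997, Thm. 1.2 / §8] [cite: LiQinWang2003, §6 p. 13] -/
theorem NakajimaOperators.heisenbergMonomialBasisSummand_apply (𝔑 : NakajimaOperators hS H) {N : ℕ}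
    {x : Fin N → totalCohomology ℂ (ComplexPoints S)} {deg : Fin N → ℕ}
    (hdeg : ∀ c, x c ∈ LinearMap.range (ofDegree ℂ (ComplexPoints S) (deg c))) (hli : LinearIndependent ℂ x)
    (hsp : Submodule.span ℂ (Set.range x) = ⊤) (n : ℕ)
    (ρ : {ρ : Fin N → Fin (n + 1) → ℕ // IsPartitionValued deg n ρ}) :
    Fock.ofSummand ℂ (fockFamily H) n (𝔑.heisenbergMonomialBasisSummand hdeg hli hsp n ρ) =
      heisenbergMonomial 𝔑.q (vacuumVector H) x n ρ.1 := by
  rw [NakajimaOperators.heisenbergMonomialBasisSummand, Module.Basis.map_apply, Module.Basis.map_apply,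
    ← LinearEquiv.ofInjective_apply (h := Fock.ofSummand_injective (K := ℂ) (Φ := fockFamily H) n),
    LinearEquiv.apply_symm_apply, LinearEquiv.coe_ofEq_apply, Module.Basis.span_apply]

/-- **The Heisenberg monomial basis of `Hᵈ(S^[n](ℂ); ℂ)`** indexed by `{ρ ∈ 𝒫ₙ : pvDegree ρ = d}`, as a
`Module.Basis` of the tree's `complexBetti (S^[n]) d`; its `ρ`-th vector maps to `Π_c 𝔞_{−ρ(c)}(x_c)|0⟩` in `ℍ`
(`heisenbergMonomialBasisOfDegree_apply`). [cite: Nakajima1997, Thm. 1.2 / §8] [cite: LiQinWang2002, Def. 2.9 p. 5]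
[cite: LiQinWang2003, §6 pp. 13–14] -/
def NakajimaOperators.heisenbergMonomialBasisOfDegree (𝔑 : NakajimaOperators hS H) {N : ℕ}
    {x : Fin N → totalCohomology ℂ (ComplexPoints S)} {deg : Fin N → ℕ}
    (hdeg : ∀ c, x c ∈ LinearMap.range (ofDegree ℂ (ComplexPoints S) (deg c))) (hli : LinearIndependent ℂ x)
    (hsp : Submodule.span ℂ (Set.range x) = ⊤) (n d : ℕ) :
    Module.Basis {ρ : Fin N → Fin (n + 1) → ℕ // IsPartitionValued deg n ρ ∧ pvDegree deg n ρ = d} ℂ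
      (complexBetti (H.obj n) d) :=
  ((Module.Basis.span (𝔑.heisenbergMonomial_basis_of_degree hdeg hli hsp n d).1).map
    (LinearEquiv.ofEq _ _ (𝔑.heisenbergMonomial_basis_of_degree hdeg hli hsp n d).2)).map
      (LinearEquiv.ofInjective _ (Fock.of_injective (K := ℂ) (Φ := fockFamily H) n d)).symm

/-- The `ρ`-th basis vector of `Hᵈ(S^[n])` is the monomial `Π_c 𝔞_{−ρ(c)}(x_c)|0⟩` (read in `ℍ`).
[cite: Nakajima1997, Thm. 1.2 / §8] [cite: LiQinWang2003, §6 p. 13] -/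
theorem NakajimaOperators.heisenbergMonomialBasisOfDegree_apply (𝔑 : NakajimaOperators hS H) {N : ℕ}
    {x : Fin N → totalCohomology ℂ (ComplexPoints S)} {deg : Fin N → ℕ}
    (hdeg : ∀ c, x c ∈ LinearMap.range (ofDegree ℂ (ComplexPoints S) (deg c))) (hli : LinearIndependent ℂ x)
    (hsp : Submodule.span ℂ (Set.range x) = ⊤) (n d : ℕ)
    (ρ : {ρ : Fin N → Fin (n + 1) → ℕ // IsPartitionValued deg n ρ ∧ pvDegree deg n ρ = d}) :
    Fock.of ℂ (fockFamily H) n d (𝔑.heisenbergMonomialBasisOfDegree hdeg hli hsp n d ρ) =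
      heisenbergMonomial 𝔑.q (vacuumVector H) x n ρ.1 := by
  rw [NakajimaOperators.heisenbergMonomialBasisOfDegree, Module.Basis.map_apply, Module.Basis.map_apply,
    ← LinearEquiv.ofInjective_apply (h := Fock.of_injective (K := ℂ) (Φ := fockFamily H) n d),
    LinearEquiv.apply_symm_apply, LinearEquiv.coe_ofEq_apply, Module.Basis.span_apply]

end Bases

end Literature.AlgebraicGeometry.HilbertScheme

end
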